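import Summits.Ventures.Crystal3D.Theorems.StickyWulffConstantPolycrystalWulffBoundGapSlabPrelim
import Summits.Ventures.Crystal3D.Theorems.StickyWulffConstantPolycrystalWulffBoundCapHeight
import Summits.Ventures.Crystal3D.Theorems.StickyWulffConstantPolycrystalWulffBoundHyperplaneNull

/-!
# `PolycrystalWulffBound`, line `PolyDensity`: MONOTONE basal cut heights and the volumes of the slab
# pieces `W(A) ∩ {⟪y, m⟫ ∈ [α_lo, α_hi]}` (helpers for the slab-forest rung; crux `stmt-Ventures-19482`)

Route `StickyWulffConstant` of the venture `Summits/Ventures/Crystal3D`, second prover lane (poly-p2,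
gen 14).  For the slab-forest construction (memo P-GAP-g14 §6.7) the basal planes of the texture are
matched with cut heights `α_0 ≤ α_1 ≤ … ≤ α_L` of the Wulff body whose upper caps have prescribed
(antitone) volume fractions; `exists_capHeight_eq` gives heights one at a time, and a running maximum
makes them monotone without changing the cap volumes (`exists_mono_capHeights`).  The slab piece
between two consecutive heights then has volume = the difference of the cap volumes
(`volume_cruxWulffBody_slabPiece`; closed slabs, the boundary planes being null).
WHAT THIS IS NOT: anything about the crux itself.
-/

noncomputable section

open scoped BigOperators InnerProductSpace ENNReal Pointwise
open MeasureTheory Set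

namespace Summit.Ventures.Crystal3D.Theorems

open Summit.Ventures.Crystal3D.Cruxes.TextureLiminf.TexShadow (E3)
open Literature.MathematicalPhysics.StatisticalMechanics (fccStacking)

/-- **Monotone cap heights.**  For a frame `A`, a unit `m` and fractions `ρ : Fin (L+1) → [0,1]` that
are ANTITONE in the index, there are heights `α`, MONOTONE in the index, with
`|W(A) ∩ {α i < ⟪y, m⟫}| = 32·ρ i` for every `i`. -/
theorem exists_mono_capHeights (A : E3 ≃ₗᵢ[ℝ] E3) {m : E3} (hm : ‖m‖ = 1) {L : ℕ}
    (ρ : Fin (L + 1) → ℝ) (hρ0 : ∀ i, 0 ≤ ρ i) (hρ1 : ∀ i, ρ i ≤ 1)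
    (hanti : ∀ i j, i ≤ j → ρ j ≤ ρ i) :
    ∃ α : Fin (L + 1) → ℝ, Monotone α ∧ ∀ i,
      volume ({y : E3 | ∀ ν : E3, ⟪y, ν⟫_ℝ ≤ Real.sqrt 2 / 4 *
        ∑ᶠ w ∈ {w | w ∈ fccStacking 1 (Real.sqrt (2 / 3)) ∧ ‖w‖ = 1}, |⟪w, A.symm ν⟫_ℝ|} ∩
        {y : E3 | α i < ⟪y, m⟫_ℝ}) = ENNReal.ofReal (32 * ρ i) := by
  classical
  set W : Set E3 := {y : E3 | ∀ ν : E3, ⟪y, ν⟫_ℝ ≤ Real.sqrt 2 / 4 *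
    ∑ᶠ w ∈ {w | w ∈ fccStacking 1 (Real.sqrt (2 / 3)) ∧ ‖w‖ = 1}, |⟪w, A.symm ν⟫_ℝ|} with hW
  have h := fun i => exists_capHeight_eq A m hm (hρ0 i) (hρ1 i)
  choose α₀ _ hα₀ using h
  -- running maximum
  set α : Fin (L + 1) → ℝ := fun i =>
    (Finset.univ.filter (fun j : Fin (L + 1) => j ≤ i)).sup' ⟨i, by simp⟩ α₀ with hα
  refine ⟨α, ?_, ?_⟩
  · intro i j hij
    simp only [hα]
    refine Finset.sup'_le _ _ fun j' hj' => ?_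
    rw [Finset.mem_filter] at hj'
    have hmem : j' ∈ Finset.univ.filter (fun j'' : Fin (L + 1) => j'' ≤ j) :=
      Finset.mem_filter.2 ⟨Finset.mem_univ _, hj'.2.trans hij⟩
    exact Finset.le_sup' α₀ hmem
  · intro i
    -- `α i = α₀ j` for some `j ≤ i`, and `α₀ i ≤ α i`
    obtain ⟨j, hj, hαj⟩ : ∃ j, j ≤ i ∧ α i = α₀ j := by
      obtain ⟨j, hjmem, hj⟩ := Finset.exists_mem_eq_sup' (⟨i, by simp⟩ :
        (Finset.univ.filter (fun j : Fin (L + 1) => j ≤ i)).Nonempty) α₀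
      rw [Finset.mem_filter] at hjmem
      exact ⟨j, hjmem.2, hj⟩
    have hle : α₀ i ≤ α i := by
      have hmem : i ∈ Finset.univ.filter (fun j'' : Fin (L + 1) => j'' ≤ i) :=
        Finset.mem_filter.2 ⟨Finset.mem_univ _, le_rfl⟩
      exact Finset.le_sup' α₀ hmem
    apply le_antisymm
    · -- `cap(α i) ⊆ cap(α₀ i)`
      calc volume (W ∩ {y : E3 | α i < ⟪y, m⟫_ℝ}) ≤ volume (W ∩ {y : E3 | α₀ i < ⟪y, m⟫_ℝ}) :=
            measure_mono (inter_subset_inter_right _ fun y (hy : α i < ⟪y, m⟫_ℝ) => by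
              show α₀ i < ⟪y, m⟫_ℝ; linarith)
        _ = ENNReal.ofReal (32 * ρ i) := hα₀ i
    · -- `cap(α i) = cap(α₀ j)` has volume `32 ρ j ≥ 32 ρ i`
      rw [hαj, hα₀ j]
      exact ENNReal.ofReal_le_ofReal (by nlinarith [hanti j i hj])

/-- **Volume of a closed slab piece** of the crux's Wulff body between two cut heights with known open
cap volumes: for `lo ≤ hi`, `|W(A) ∩ {lo ≤ ⟪y,m⟫ ≤ hi}| = |W(A) ∩ {lo < ⟪y,m⟫}| − |W(A) ∩ {hi < ⟪y,m⟫}|`. -/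
theorem volume_cruxWulffBody_slabPiece (A : E3 ≃ₗᵢ[ℝ] E3) {m : E3} (hm : ‖m‖ = 1) {lo hi : ℝ}
    (hlohi : lo ≤ hi) :
    volume ({y : E3 | ∀ ν : E3, ⟪y, ν⟫_ℝ ≤ Real.sqrt 2 / 4 *
        ∑ᶠ w ∈ {w | w ∈ fccStacking 1 (Real.sqrt (2 / 3)) ∧ ‖w‖ = 1}, |⟪w, A.symm ν⟫_ℝ|} ∩
        {y : E3 | ⟪y, m⟫_ℝ ∈ Icc lo hi}) =
      volume ({y : E3 | ∀ ν : E3, ⟪y, ν⟫_ℝ ≤ Real.sqrt 2 / 4 *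
        ∑ᶠ w ∈ {w | w ∈ fccStacking 1 (Real.sqrt (2 / 3)) ∧ ‖w‖ = 1}, |⟪w, A.symm ν⟫_ℝ|} ∩
        {y : E3 | lo < ⟪y, m⟫_ℝ}) -
      volume ({y : E3 | ∀ ν : E3, ⟪y, ν⟫_ℝ ≤ Real.sqrt 2 / 4 *
        ∑ᶠ w ∈ {w | w ∈ fccStacking 1 (Real.sqrt (2 / 3)) ∧ ‖w‖ = 1}, |⟪w, A.symm ν⟫_ℝ|} ∩
        {y : E3 | hi < ⟪y, m⟫_ℝ}) := by
  set W : Set E3 := {y : E3 | ∀ ν : E3, ⟪y, ν⟫_ℝ ≤ Real.sqrt 2 / 4 *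
    ∑ᶠ w ∈ {w | w ∈ fccStacking 1 (Real.sqrt (2 / 3)) ∧ ‖w‖ = 1}, |⟪w, A.symm ν⟫_ℝ|} with hW
  have hWc : IsCompact W := isCompact_cruxWulffBody A
  have hWm : MeasurableSet W := hWc.isClosed.measurableSet
  have hm0 : m ≠ 0 := by intro h; rw [h, norm_zero] at hm; exact zero_ne_one hm
  have hnull : volume {y : E3 | ⟪m, y⟫_ℝ = lo} = 0 := volume_setOf_inner_eq_zero hm0 lo
  have hgt_m : ∀ a : ℝ, MeasurableSet {y : E3 | a < ⟪y, m⟫_ℝ} := fun a =>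
    measurableSet_lt measurable_const (measurable_id.inner measurable_const)
  -- closed-below slab = (open cap lo \ open cap hi) ∪ (plane piece), the latter null
  have h1 : W ∩ {y : E3 | ⟪y, m⟫_ℝ ∈ Icc lo hi} =
      (W ∩ {y : E3 | lo < ⟪y, m⟫_ℝ}) \ (W ∩ {y : E3 | hi < ⟪y, m⟫_ℝ}) ∪
        (W ∩ {y : E3 | ⟪y, m⟫_ℝ ∈ Icc lo hi} ∩ {y : E3 | ⟪m, y⟫_ℝ = lo}) := by
    ext y
    simp only [mem_union, mem_sdiff, mem_inter_iff, mem_setOf_eq, mem_Icc, real_inner_comm m y]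
    constructor
    · rintro ⟨hy, h1, h2⟩
      rcases eq_or_lt_of_le h1 with h | h
      · exact Or.inr ⟨⟨hy, h1, h2⟩, h.symm⟩
      · exact Or.inl ⟨⟨hy, h⟩, fun h' => absurd h'.2 (not_lt.2 h2)⟩
    · rintro (⟨⟨hy, h⟩, h'⟩ | ⟨⟨hy, h1, h2⟩, -⟩)
      · refine ⟨hy, h.le, ?_⟩
        by_contra hc
        exact h' ⟨hy, lt_of_not_ge hc⟩
      · exact ⟨hy, h1, h2⟩
  have hnull' : volume (W ∩ {y : E3 | ⟪y, m⟫_ℝ ∈ Icc lo hi} ∩ {y : E3 | ⟪m, y⟫_ℝ = lo}) = 0 :=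
    measure_mono_null inter_subset_right hnull
  have hsub : W ∩ {y : E3 | hi < ⟪y, m⟫_ℝ} ⊆ W ∩ {y : E3 | lo < ⟪y, m⟫_ℝ} :=
    inter_subset_inter_right _ fun y (hy : hi < ⟪y, m⟫_ℝ) => by
      show lo < ⟪y, m⟫_ℝ; exact lt_of_le_of_lt hlohi hy
  have hfin : volume (W ∩ {y : E3 | hi < ⟪y, m⟫_ℝ}) ≠ ⊤ :=
    (lt_of_le_of_lt (measure_mono inter_subset_left) hWc.measure_lt_top).ne
  have hD : volume ((W ∩ {y : E3 | lo < ⟪y, m⟫_ℝ}) \ (W ∩ {y : E3 | hi < ⟪y, m⟫_ℝ})) =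
      volume (W ∩ {y : E3 | lo < ⟪y, m⟫_ℝ}) - volume (W ∩ {y : E3 | hi < ⟪y, m⟫_ℝ}) :=
    measure_sdiff hsub (hWm.inter (hgt_m hi)).nullMeasurableSet hfin
  rw [h1, ← hD]
  apply le_antisymm
  · calc volume ((W ∩ {y : E3 | lo < ⟪y, m⟫_ℝ}) \ (W ∩ {y : E3 | hi < ⟪y, m⟫_ℝ}) ∪
          (W ∩ {y : E3 | ⟪y, m⟫_ℝ ∈ Icc lo hi} ∩ {y : E3 | ⟪m, y⟫_ℝ = lo}))
        ≤ volume ((W ∩ {y : E3 | lo < ⟪y, m⟫_ℝ}) \ (W ∩ {y : E3 | hi < ⟪y, m⟫_ℝ})) +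
          volume (W ∩ {y : E3 | ⟪y, m⟫_ℝ ∈ Icc lo hi} ∩ {y : E3 | ⟪m, y⟫_ℝ = lo}) := measure_union_le _ _
      _ = volume ((W ∩ {y : E3 | lo < ⟪y, m⟫_ℝ}) \ (W ∩ {y : E3 | hi < ⟪y, m⟫_ℝ})) := by
          rw [hnull', add_zero]
  · exact measure_mono subset_union_left

end Summit.Ventures.Crystal3D.Theorems

end
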